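import Mathlib
import HarnessLib
import Summits.Ventures.LatticeQCDFlow.Scoring.WeightedBlockSumCLT
import Summits.Ventures.LatticeQCDFlow.Scoring.DeltaMethod
import Summits.Ventures.LatticeQCDFlow.Scoring.AsymptoticCoverage
import Summits.Ventures.LatticeQCDFlow.Scoring.DoeblinPowerGeometricEnvelope

/-!
# THE HALVES TEST FROM ANY START: `√b_n (Ā_n − B̄_n) ⇒ N(0, 2σ²_f)` — the two half means of ONE
# run are asymptotically independent, so scorer A's `V4` denominator `√(err_A² + err_B²)` is
# asymptotically exact and `z = |Ā − B̄|/√(err_A² + err_B²)` is asymptotically `|N(0,1)|`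

HONEST FRAMING: exact (Metropolis-corrected) sampling algorithms for lattice gauge theory;
figures of merit are autocorrelation/cost numbers at stated couplings and volumes; no
continuum-physics claim.

Venture `LatticeQCDFlow` (cell pub-lqcd), topic `Scoring`; FANOUT row 4 (`s0-u1-b`, GEN-32).
NEW WORK of the cell, not a published result; no definition is introduced; nothing is cited as a
fact.  `Scoring/HalvesTest.lean` (row 11) analysed the frozen scorer A's validity test `V4` at the
population level: the printed `z = |A − B|/√(err_A² + err_B²)` treats the two half means of one
stream as INDEPENDENT, whereas `Var(A − B) = Var A + Var B − 2 Cov(A, B)` in general.  This file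
proves that the independence reading is ASYMPTOTICALLY EXACT for every kernel with a geometric
sup-norm envelope `(A, ρ)` (every kernel one of whose powers is Doeblin), every bounded measurable
observable and EVERY initial law: with half length `b_n → ∞`, `√b_n (Ā_n − B̄_n) ⇒ N(0, 2σ²_f)`,
`σ²_f` the Green–Kubo variance of ONE half mean's `√b`-fluctuation — the covariance of the two
halves vanishes at the CLT scale (it is the `a = 2`, `u = (1, −1)` case of
`Scoring/WeightedBlockSumCLT.chain_weightedBlockSum_clt_of_envelope`).  Consequently, for ANY
within-half error estimates `err_A², err_B²` (measurable functions of the path) that are consistent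
in the sense `b_n · err² → σ²_f` in probability, and `σ²_f > 0`, the printed statistic
`(Ā_n − B̄_n)/√(err_A² + err_B²)` converges in distribution to `N(0,1)` and
`P(|z| ≤ z₀) → N(0,1)([−z₀, z₀])`: `V4`'s hard threshold `z > 3.5` has asymptotic false-alarm rate
`2(1 − Φ(3.5))` for a healthy exact sampler, whatever the start.  Printed counterpart NAMED ONLY:
asymptotic independence of non-overlapping batch means (Schmeiser 1982; Glynn–Iglehart 1990),
nothing cited as a fact.

## Content (`π` invariant, envelope `(A, ρ)`, `0 ≤ A`, `0 ≤ ρ < 1`; `|f| ≤ C` measurable;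
## `Ā_n = (1/b_n) Σ_{i<b_n} f(X_i)`, `B̄_n = (1/b_n) Σ_{i<b_n} f(X_{b_n+i})`; `P_{μ₀}` from ANY `μ₀`)

* **`chain_halves_difference_clt_of_envelope`** — `(Σ_{i<b_n} f̄(X_i) − Σ_{i<b_n} f̄(X_{b_n+i}))/√b_n ⇒ Y`,
  `Y ∼ N(0, 2σ²_f)`;
* **`chain_halves_studentized_clt_of_envelope`** — `σ²_f > 0`, `b_n·V^A_n → σ²_f`, `b_n·V^B_n → σ²_f`
  in probability (measurable `V^A_n, V^B_n ≥ 0`): `(Ā_n − B̄_n)/√(V^A_n + V^B_n) ⇒ N(0,1)`;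
* **`chain_halves_coverage_of_envelope`** — `P_{μ₀}(|(Ā_n − B̄_n)/√(V^A_n + V^B_n)| ≤ z₀) → N(0,1)([−z₀, z₀])`.

NOT CLAIMED: consistency of the Γ-method error bars the scorer actually uses inside each half (any
consistent estimator qualifies; batch means within a half is `Scoring/BatchMeansConsistencyEnvelope`
for the first half); finite-`b` corrections; any number of ours.
-/

noncomputable section

namespace Summit.Ventures.LatticeQCDFlow.Scoring

open MeasureTheory ProbabilityTheory Filter Finset Preorder
open scoped ENNReal Topology

variable {Ω : Type*} [MeasurableSpace Ω]

section Envelope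

variable {κ : Kernel Ω Ω} [IsMarkovKernel κ] {π : Measure Ω} [IsProbabilityMeasure π] {A ρ : ℝ}

/-- **THE TWO HALVES OF ONE RUN ARE ASYMPTOTICALLY INDEPENDENT GAUSSIANS**: `π` invariant,
envelope `(A, ρ)`, `|f| ≤ C` measurable, `b_n → ∞`, any start; for every `Y ∼ N(0, 2σ²_f)`:
`(Σ_{i<b_n} f̄(X_i) − Σ_{i<b_n} f̄(X_{b_n+i}))/√b_n ⇒ Y` (`= √b_n (Ā_n − B̄_n)`). -/
theorem chain_halves_difference_clt_of_envelope (hπ : Kernel.Invariant κ π)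
    (henv : ∀ (g : Ω → ℝ), Measurable g → ∀ (Cg : ℝ), (∀ x, |g x| ≤ Cg) →
      ∀ (t : ℕ) (x : Ω), |(kop κ)^[t] g x - ∫ y, g y ∂π| ≤ 2 * Cg * (A * ρ ^ t))
    (hA : 0 ≤ A) (hρ0 : 0 ≤ ρ) (hρ1 : ρ < 1)
    {f : Ω → ℝ} (hf : Measurable f) {C : ℝ} (hC : ∀ x, |f x| ≤ C)
    (μ₀ : Measure Ω) [IsProbabilityMeasure μ₀] {b : ℕ → ℕ} (hb : Tendsto b atTop atTop)
    {Ω' : Type*} [MeasurableSpace Ω'] {P' : Measure Ω'} [IsProbabilityMeasure P'] {Y : Ω' → ℝ}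
    (hY : HasLaw Y (gaussianReal 0 (Real.toNNReal (2
      * (((∫ y, (f y - ∫ z, f z ∂(π)) ^ 2 ∂(π)) + 2 * ∑' k, ∫ y, (f y - ∫ z, f z ∂(π)) * (kop (κ))^[k + 1] (fun y => f y - ∫ z, f z ∂(π)) y ∂(π)))))) P')
    [IsProbabilityMeasure (Kernel.trajMeasure (X := fun _ : ℕ => Ω) (μ₀)
          (fun n : ℕ => κ.comap (fun h' : (i : ↥(Finset.Iic n)) → Ω => h' ⟨n, Finset.mem_Iic.2 le_rfl⟩)
            (measurable_pi_apply _)))] :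
    TendstoInDistribution (fun (n : ℕ) (x : ℕ → Ω) =>
        ((∑ r ∈ Finset.range (b n), (f (x r) - ∫ z, f z ∂π))
          - ∑ r ∈ Finset.range (b n), (f (x (b n + r)) - ∫ z, f z ∂π)) / Real.sqrt (b n))
      atTop Y (fun _ => (Kernel.trajMeasure (X := fun _ : ℕ => Ω) (μ₀)
            (fun n : ℕ => κ.comap (fun h' : (i : ↥(Finset.Iic n)) → Ω => h' ⟨n, Finset.mem_Iic.2 le_rfl⟩)
              (measurable_pi_apply _)))) P' := by
  set u : ℕ → ℝ := fun j => if j = 0 then 1 else -1 with hu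
  have hsum : (∑ j ∈ Finset.range 2, u j ^ 2) = 2 := by
    norm_num [hu, Finset.sum_range_succ]
  have hY' : HasLaw Y (gaussianReal 0 (Real.toNNReal ((∑ j ∈ Finset.range 2, u j ^ 2)
      * (((∫ y, (f y - ∫ z, f z ∂(π)) ^ 2 ∂(π)) + 2 * ∑' k, ∫ y, (f y - ∫ z, f z ∂(π)) * (kop (κ))^[k + 1] (fun y => f y - ∫ z, f z ∂(π)) y ∂(π)))))) P' := by
    rw [hsum]; exact hY
  have h := chain_weightedBlockSum_clt_of_envelope hπ henv hA hρ0 hρ1 hf hC μ₀ u 2 hb hY'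
  refine h.congr (fun n => ae_of_all _ fun x => ?_) (ae_of_all _ fun ω => rfl)
  show (∑ j ∈ Finset.range 2, u j * ∑ r ∈ Finset.range (b n), (f (x (b n * j + r)) - ∫ z, f z ∂π))
        / Real.sqrt (b n)
      = ((∑ r ∈ Finset.range (b n), (f (x r) - ∫ z, f z ∂π))
          - ∑ r ∈ Finset.range (b n), (f (x (b n + r)) - ∫ z, f z ∂π)) / Real.sqrt (b n)
  simp [hu, Finset.sum_range_succ]

/-- **THE STUDENTISED HALVES STATISTIC IS ASYMPTOTICALLY STANDARD NORMAL, FROM ANY START.**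
Same setting with `σ²_f > 0`; `V^A_n, V^B_n` measurable (squared) error bars of the two half means
whose COMBINATION is consistent, `b_n · (V^A_n + V^B_n) → 2σ²_f` in probability; `Z ∼ N(0,1)`.
Then `(Ā_n − B̄_n)/√(V^A_n + V^B_n) ⇒ Z`. -/
theorem chain_halves_studentized_clt_of_envelope (hπ : Kernel.Invariant κ π)
    (henv : ∀ (g : Ω → ℝ), Measurable g → ∀ (Cg : ℝ), (∀ x, |g x| ≤ Cg) →
      ∀ (t : ℕ) (x : Ω), |(kop κ)^[t] g x - ∫ y, g y ∂π| ≤ 2 * Cg * (A * ρ ^ t))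
    (hA : 0 ≤ A) (hρ0 : 0 ≤ ρ) (hρ1 : ρ < 1)
    {f : Ω → ℝ} (hf : Measurable f) {C : ℝ} (hC : ∀ x, |f x| ≤ C)
    (hσ : 0 < ((∫ y, (f y - ∫ z, f z ∂(π)) ^ 2 ∂(π)) + 2 * ∑' k, ∫ y, (f y - ∫ z, f z ∂(π)) * (kop (κ))^[k + 1] (fun y => f y - ∫ z, f z ∂(π)) y ∂(π)))
    (μ₀ : Measure Ω) [IsProbabilityMeasure μ₀] {b : ℕ → ℕ} (hb : Tendsto b atTop atTop)
    {VA VB : ℕ → (ℕ → Ω) → ℝ} (hVAm : ∀ n, Measurable (VA n)) (hVBm : ∀ n, Measurable (VB n))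
    (hV : TendstoInMeasure (Kernel.trajMeasure (X := fun _ : ℕ => Ω) (μ₀)
          (fun n : ℕ => κ.comap (fun h' : (i : ↥(Finset.Iic n)) → Ω => h' ⟨n, Finset.mem_Iic.2 le_rfl⟩)
            (measurable_pi_apply _)))
        (fun n x => (b n : ℝ) * (VA n x + VB n x)) atTop
        (fun _ => 2 * (((∫ y, (f y - ∫ z, f z ∂(π)) ^ 2 ∂(π)) + 2 * ∑' k, ∫ y, (f y - ∫ z, f z ∂(π)) * (kop (κ))^[k + 1] (fun y => f y - ∫ z, f z ∂(π)) y ∂(π)))))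
    {Ω' : Type*} [MeasurableSpace Ω'] {P' : Measure Ω'} [IsProbabilityMeasure P'] {Z : Ω' → ℝ}
    (hZ : HasLaw Z (gaussianReal 0 1) P')
    [IsProbabilityMeasure (Kernel.trajMeasure (X := fun _ : ℕ => Ω) (μ₀)
          (fun n : ℕ => κ.comap (fun h' : (i : ↥(Finset.Iic n)) → Ω => h' ⟨n, Finset.mem_Iic.2 le_rfl⟩)
            (measurable_pi_apply _)))] :
    TendstoInDistribution (fun (n : ℕ) (x : ℕ → Ω) =>
        ((∑ r ∈ Finset.range (b n), f (x r)) / (b n) - (∑ r ∈ Finset.range (b n), f (x (b n + r))) / (b n))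
          / Real.sqrt (VA n x + VB n x))
      atTop Z (fun _ => (Kernel.trajMeasure (X := fun _ : ℕ => Ω) (μ₀)
            (fun n : ℕ => κ.comap (fun h' : (i : ↥(Finset.Iic n)) → Ω => h' ⟨n, Finset.mem_Iic.2 le_rfl⟩)
              (measurable_pi_apply _)))) P' := by
  set P := (Kernel.trajMeasure (X := fun _ : ℕ => Ω) (μ₀)
        (fun n : ℕ => κ.comap (fun h' : (i : ↥(Finset.Iic n)) → Ω => h' ⟨n, Finset.mem_Iic.2 le_rfl⟩)
          (measurable_pi_apply _))) with hP
  set σ2 : ℝ := ((∫ y, (f y - ∫ z, f z ∂(π)) ^ 2 ∂(π)) + 2 * ∑' k, ∫ y, (f y - ∫ z, f z ∂(π)) * (kop (κ))^[k + 1] (fun y => f y - ∫ z, f z ∂(π)) y ∂(π)) with hσ2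
  -- (1) the numerator CLT with limit `√(2σ²) · Z`
  have hY : HasLaw (fun ω => Real.sqrt (2 * σ2) * Z ω) (gaussianReal 0 (Real.toNNReal (2 * σ2))) P' := by
    have h := gaussianReal_const_mul hZ (Real.sqrt (2 * σ2))
    rw [mul_zero] at h
    convert h using 2
    apply NNReal.eq
    rw [Real.coe_toNNReal _ (by positivity), NNReal.coe_mul, NNReal.coe_mk, NNReal.coe_one, mul_one,
      Real.sq_sqrt (by positivity)]
  have hnum := chain_halves_difference_clt_of_envelope hπ henv hA hρ0 hρ1 hf hC μ₀ hb hY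
  -- (2) the denominator: `1/√(b (V^A + V^B)) → 1/√(2σ²)` in probability
  have hφ : ContinuousAt (fun v : ℝ => 1 / Real.sqrt v) (2 * σ2) := by
    have : Real.sqrt (2 * σ2) ≠ 0 := (Real.sqrt_pos.2 (by positivity)).ne'
    exact continuousAt_const.div Real.continuous_sqrt.continuousAt this
  have hinv := CardConsistency.tendstoInMeasure_comp_continuousAt hV hφ
  have hDm : ∀ n, Measurable fun x : ℕ → Ω => 1 / Real.sqrt ((b n : ℝ) * (VA n x + VB n x)) := fun n =>
    (((hVAm n).add (hVBm n)).const_mul _).sqrt.const_div 1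
  -- (3) Slutsky: product with the convergent-in-probability factor
  have hprod := hnum.continuous_comp_prodMk_of_tendstoInMeasure_const (g := fun p : ℝ × ℝ => p.1 * p.2)
    (by fun_prop) hinv (fun n => (hDm n).aemeasurable)
  have hlim : ∀ ω, (fun p : ℝ × ℝ => p.1 * p.2) (Real.sqrt (2 * σ2) * Z ω, 1 / Real.sqrt (2 * σ2)) = Z ω := by
    intro ω
    have : Real.sqrt (2 * σ2) ≠ 0 := (Real.sqrt_pos.2 (by positivity)).ne'
    field_simp
  have hprod' := hprod.congr (fun n => EventuallyEq.rfl) (ae_of_all _ hlim)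
  -- (4) the printed statistic equals the product as soon as `b_n > 0`
  refine tendstoInDistribution_of_tendstoInMeasure_sub _ Z hprod' ?_ (fun n => ?_)
  · have h0 : TendstoInMeasure P (fun (_ : ℕ) (_ : ℕ → Ω) => (0 : ℝ)) atTop (fun _ => (0 : ℝ)) :=
      tendstoInMeasure_of_tendsto_ae (fun _ => aestronglyMeasurable_const)
        (ae_of_all _ fun _ => tendsto_const_nhds)
    refine h0.congr' ?_ EventuallyEq.rfl
    filter_upwards [hb.eventually_gt_atTop 0] with n hn
    refine ae_of_all _ fun x => ?_
    have hbR : (0 : ℝ) < b n := Nat.cast_pos.2 hn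
    have hsq : Real.sqrt (b n : ℝ) * Real.sqrt (b n) = b n := Real.mul_self_sqrt hbR.le
    have hsum_sub : (∑ r ∈ Finset.range (b n), (f (x r) - ∫ z, f z ∂π))
        - ∑ r ∈ Finset.range (b n), (f (x (b n + r)) - ∫ z, f z ∂π)
        = (∑ r ∈ Finset.range (b n), f (x r)) - ∑ r ∈ Finset.range (b n), f (x (b n + r)) := by
      rw [Finset.sum_sub_distrib, Finset.sum_sub_distrib]; ring
    simp only [Pi.sub_apply]
    show (0 : ℝ) = ((∑ r ∈ Finset.range (b n), f (x r)) / (b n) - (∑ r ∈ Finset.range (b n), f (x (b n + r))) / (b n))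
          / Real.sqrt (VA n x + VB n x)
        - ((∑ r ∈ Finset.range (b n), (f (x r) - ∫ z, f z ∂π))
            - ∑ r ∈ Finset.range (b n), (f (x (b n + r)) - ∫ z, f z ∂π)) / Real.sqrt (b n)
          * (1 / Real.sqrt ((b n : ℝ) * (VA n x + VB n x)))
    rw [hsum_sub, Real.sqrt_mul hbR.le]
    have e1 : ((∑ r ∈ Finset.range (b n), f (x r)) - ∑ r ∈ Finset.range (b n), f (x (b n + r))) / Real.sqrt (b n)
          * (1 / (Real.sqrt (b n) * Real.sqrt (VA n x + VB n x)))
        = ((∑ r ∈ Finset.range (b n), f (x r)) - ∑ r ∈ Finset.range (b n), f (x (b n + r)))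
          / ((Real.sqrt (b n) * Real.sqrt (b n)) * Real.sqrt (VA n x + VB n x)) := by
      ring
    rw [e1, hsq]
    ring
  · exact ((((Finset.measurable_sum _ fun r _ => hf.comp (measurable_pi_apply _)).div_const _).sub
      ((Finset.measurable_sum _ fun r _ => hf.comp (measurable_pi_apply _)).div_const _)).div
      (((hVAm n).add (hVBm n)).sqrt)).aemeasurable

/-- **THE HALVES TEST IS CALIBRATED**: under the hypotheses of
`chain_halves_studentized_clt_of_envelope`, for every `z₀`:
`P_{μ₀}(|(Ā_n − B̄_n)/√(V^A_n + V^B_n)| ≤ z₀) → N(0,1)([−z₀, z₀])`. -/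
theorem chain_halves_coverage_of_envelope (hπ : Kernel.Invariant κ π)
    (henv : ∀ (g : Ω → ℝ), Measurable g → ∀ (Cg : ℝ), (∀ x, |g x| ≤ Cg) →
      ∀ (t : ℕ) (x : Ω), |(kop κ)^[t] g x - ∫ y, g y ∂π| ≤ 2 * Cg * (A * ρ ^ t))
    (hA : 0 ≤ A) (hρ0 : 0 ≤ ρ) (hρ1 : ρ < 1)
    {f : Ω → ℝ} (hf : Measurable f) {C : ℝ} (hC : ∀ x, |f x| ≤ C)
    (hσ : 0 < ((∫ y, (f y - ∫ z, f z ∂(π)) ^ 2 ∂(π)) + 2 * ∑' k, ∫ y, (f y - ∫ z, f z ∂(π)) * (kop (κ))^[k + 1] (fun y => f y - ∫ z, f z ∂(π)) y ∂(π)))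
    (μ₀ : Measure Ω) [IsProbabilityMeasure μ₀] {b : ℕ → ℕ} (hb : Tendsto b atTop atTop)
    {VA VB : ℕ → (ℕ → Ω) → ℝ} (hVAm : ∀ n, Measurable (VA n)) (hVBm : ∀ n, Measurable (VB n))
    (hV : TendstoInMeasure (Kernel.trajMeasure (X := fun _ : ℕ => Ω) (μ₀)
          (fun n : ℕ => κ.comap (fun h' : (i : ↥(Finset.Iic n)) → Ω => h' ⟨n, Finset.mem_Iic.2 le_rfl⟩)
            (measurable_pi_apply _)))
        (fun n x => (b n : ℝ) * (VA n x + VB n x)) atTop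
        (fun _ => 2 * (((∫ y, (f y - ∫ z, f z ∂(π)) ^ 2 ∂(π)) + 2 * ∑' k, ∫ y, (f y - ∫ z, f z ∂(π)) * (kop (κ))^[k + 1] (fun y => f y - ∫ z, f z ∂(π)) y ∂(π)))))
    [IsProbabilityMeasure (Kernel.trajMeasure (X := fun _ : ℕ => Ω) (μ₀)
          (fun n : ℕ => κ.comap (fun h' : (i : ↥(Finset.Iic n)) → Ω => h' ⟨n, Finset.mem_Iic.2 le_rfl⟩)
            (measurable_pi_apply _)))] (z₀ : ℝ) :
    Tendsto (fun n => (Kernel.trajMeasure (X := fun _ : ℕ => Ω) (μ₀)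
            (fun n : ℕ => κ.comap (fun h' : (i : ↥(Finset.Iic n)) → Ω => h' ⟨n, Finset.mem_Iic.2 le_rfl⟩)
              (measurable_pi_apply _))).real
        {x : ℕ → Ω | |((∑ r ∈ Finset.range (b n), f (x r)) / (b n) - (∑ r ∈ Finset.range (b n), f (x (b n + r))) / (b n))
          / Real.sqrt (VA n x + VB n x)| ≤ z₀})
      atTop (𝓝 ((gaussianReal 0 1).real (Set.Icc (-z₀) z₀))) := by
  have hZ : HasLaw (fun y : ℝ => y) (gaussianReal 0 1) (gaussianReal 0 1) := ⟨aemeasurable_id, Measure.map_id'⟩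
  have h := chain_halves_studentized_clt_of_envelope hπ henv hA hρ0 hρ1 hf hC hσ μ₀ hb hVAm hVBm hV hZ
  exact CardConsistency.tendsto_measureReal_abs_le_gaussian h hZ z₀

end Envelope

end Summit.Ventures.LatticeQCDFlow.Scoring

end
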